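import Mathlib.Analysis.Calculus.Deriv.ZPow
import Mathlib.Analysis.Calculus.Deriv.Mul
import Literature.NumberTheory.Transcendental.KZCalculus
import Literature.NumberTheory.Transcendental.KZSemialgebraicComplex
import Literature.NumberTheory.Transcendental.SemialgebraicLineDeriv
import Literature.NumberTheory.Transcendental.KZIntervalPeriodProofs
import Literature.NumberTheory.Transcendental.KZCubicalCalculus
import Summits.KontsevichZagierPeriods.KontsevichZagierPeriods.Theorems.LiouvilleUnfoldingLogPrimitiveNLStubCellwiseFoldAux

/-!
# `StokesGeneration` (stmt-KontsevichZagierPeriods-3586) — line `fibrewise_stokes`, stub `stub_rungLogDerivProd`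

Registered stub R3 (Baker-sector rung) of the line `fibrewise_stokes` of the crux `StokesGeneration`
(route UnfoldedStokes): **the normalised product attached to an integer multiplicative relation.**
For real algebraic `aᵢ ∉ [0,1]` (`aᵢ < 0` or `1 < aᵢ`) and `M ∈ ℤ^s` with `Πᵢ (1 − 1/aᵢ)^{Mᵢ} = 1`,
the rational function `P(u) = Πᵢ (1 − u/aᵢ)^{Mᵢ}` satisfies: `P > 0` on `[0,1]` (every factor base
`1 − u/aᵢ` is positive there), `P(0) = 1` (a product of `1`'s), `P(1) = 1` (the relation),
`P' = P · Σᵢ Mᵢ/(u − aᵢ)` is the derivative of `P` at every point of `[0,1]` (product rule for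
`HasDerivAt.fun_finsetProd` and `d/du (1 − u/a)^M = (1 − u/a)^M · M/(u − a)`), `P, P'` are
continuous on `[0,1]`, `P'/P = Σᵢ Mᵢ/(u − aᵢ)` on `[0,1]`, and `x ↦ P (x 0)`, `x ↦ P' (x 0)` are
`ℚ`-semialgebraic functions on the closed square `[0,1]²` (finite products / sums / integer powers /
quotients of coordinate functions and real-algebraic constants, Bochnak–Coste–Roy Prop. 2.2.6; the
integer-power rule is the landed `LogPrimitiveNL.fold_fun_zpow`).

References: J. Bochnak, M. Coste, M.-F. Roy, *Real Algebraic Geometry* (1998), Prop. 2.2.6;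
M. Kontsevich, D. Zagier, *Periods* (2001), §1.1.
-/

noncomputable section

-- `Summit.KontsevichZagierPeriods.KontsevichZagierPeriods.…` is the tree's mandated layout (single-conjunct summit).
set_option linter.dupNamespace false

namespace Summit.KontsevichZagierPeriods.KontsevichZagierPeriods.Cruxes.StokesGeneration.FibrewiseStokes

open MeasureTheory Set
open Literature.NumberTheory.Transcendental
open Literature.NumberTheory.Transcendental.KZ
open Literature.ModelTheory.ExponentialFields (IsSemialgebraic)
open Summit.KontsevichZagierPeriods.LiouvilleUnfolding.LogPrimitiveNL
  (fold_fun_zpow fold_isSemialgebraicFunOn_one)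

/-! ## The factors `1 − u/a` -/

/-- For `a < 0` or `1 < a` and `u ∈ [0,1]`, the factor base `1 − u/a` is positive. [folklore] -/
theorem rung_base_pos {a : ℝ} (ha : a < 0 ∨ 1 < a) {u : ℝ} (hu : u ∈ Set.Icc (0:ℝ) 1) :
    0 < 1 - u / a := by
  rcases ha with h | h
  · have : u / a ≤ 0 := div_nonpos_of_nonneg_of_nonpos hu.1 h.le
    linarith
  · have : u / a < 1 := (div_lt_one (one_pos.trans h)).2 (lt_of_le_of_lt hu.2 h)
    linarith

/-- For `a < 0` or `1 < a` and `u ∈ [0,1]`, `u − a ≠ 0`. [folklore] -/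
theorem rung_sub_ne_zero {a : ℝ} (ha : a < 0 ∨ 1 < a) {u : ℝ} (hu : u ∈ Set.Icc (0:ℝ) 1) :
    u - a ≠ 0 := by
  intro h0
  have : u = a := sub_eq_zero.1 h0
  rcases ha with h | h
  · linarith [hu.1]
  · linarith [hu.2]

/-- The derivative of one factor: `d/du (1 − u/a)^M = (1 − u/a)^M · M/(u − a)` wherever
`1 − u/a ≠ 0` (`a ≠ 0`). [folklore] -/
theorem hasDerivAt_rung_factor {a : ℝ} (ha : a ≠ 0) (M : ℤ) {u : ℝ} (hu : 1 - u / a ≠ 0) :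
    HasDerivAt (fun v => (1 - v / a) ^ M) ((1 - u / a) ^ M * ((M : ℝ) / (u - a))) u := by
  have hua : u - a ≠ 0 := by
    intro h
    apply hu
    rw [sub_eq_zero] at h
    rw [h, div_self ha, sub_self]
  have hau : a - u ≠ 0 := fun h => hua (by linarith [sub_eq_zero.1 h])
  have hg : HasDerivAt (fun v => 1 - v / a) (-(1 / a)) u :=
    ((hasDerivAt_id' u).div_const a).const_sub 1
  have hz : HasDerivAt (fun v => (1 - v / a) ^ M) ((M : ℝ) * (1 - u / a) ^ (M - 1) * -(1 / a)) u := by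
    have := (hasDerivAt_zpow M (1 - u / a) (Or.inl hu)).comp u hg
    exact this
  refine hz.congr_deriv ?_
  rw [zpow_sub_one₀ hu]
  have hinv : (1 - u / a)⁻¹ * -(1 / a) = 1 / (u - a) := by
    field_simp
    ring
  generalize (1 - u / a) ^ M = w
  calc (M : ℝ) * (w * (1 - u / a)⁻¹) * -(1 / a)
      = w * ((M : ℝ) * ((1 - u / a)⁻¹ * -(1 / a))) := by ring
    _ = w * ((M : ℝ) / (u - a)) := by rw [hinv, mul_one_div]

/-! ## The stub -/

/-- STUB (rung, R3) **the normalised product attached to a multiplicative relation**: for real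
algebraic `aᵢ ∉ [0,1]` and `M ∈ ℤ^s` with `Πᵢ (1 − 1/aᵢ)^{Mᵢ} = 1`, the rational function
`P(u) = Πᵢ (1 − u/aᵢ)^{Mᵢ}` is positive on `[0,1]`, `P(0) = P(1) = 1`, differentiable with
`P' = P · Σᵢ Mᵢ/(u − aᵢ)`, `P, P'` continuous on `[0,1]` and `ℚ`-semialgebraic on the square (as
functions of `x 0`). [folklore] -/
theorem stub_rungLogDerivProd :
    ∀ (s : ℕ) (a : Fin s → ℝ) (M : Fin s → ℤ) (P P' : ℝ → ℝ), (∀ i, IsAlgebraic ℚ (a i)) →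
      (∀ i, a i < 0 ∨ 1 < a i) → ∏ i, (1 - (a i)⁻¹) ^ (M i) = 1 →
      (∀ u, P u = ∏ i, (1 - u / a i) ^ (M i)) →
      (∀ u, P' u = P u * ∑ i, (M i : ℝ) / (u - a i)) →
      IsSemialgebraicFunOn ℚ (Set.pi Set.univ (fun _ : Fin 2 => Set.Icc (0:ℝ) 1)) (fun x => P (x 0)) ∧
        IsSemialgebraicFunOn ℚ (Set.pi Set.univ (fun _ : Fin 2 => Set.Icc (0:ℝ) 1)) (fun x => P' (x 0)) ∧
        (∀ u ∈ Set.Icc (0:ℝ) 1, 0 < P u) ∧ P 0 = 1 ∧ P 1 = 1 ∧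
        ContinuousOn P (Set.Icc (0:ℝ) 1) ∧ ContinuousOn P' (Set.Icc (0:ℝ) 1) ∧
        (∀ u ∈ Set.Ioo (0:ℝ) 1, HasDerivAt P (P' u) u) ∧
        ∀ u ∈ Set.Icc (0:ℝ) 1, P' u / P u = ∑ i, (M i : ℝ) / (u - a i) := by
  intro s a M P P' ha ha01 hrel hP hP'
  have ha0 : ∀ i, a i ≠ 0 := fun i => by
    rcases ha01 i with h | h
    · exact h.ne
    · exact (one_pos.trans h).ne'
  -- positivity of `P` on `[0,1]`
  have hPpos : ∀ u ∈ Set.Icc (0:ℝ) 1, 0 < P u := fun u hu => by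
    rw [hP u]
    exact Finset.prod_pos fun i _ => zpow_pos (rung_base_pos (ha01 i) hu) _
  -- the derivative of `P` at every point of `[0,1]`
  have hPfun : P = fun v => ∏ i, (1 - v / a i) ^ (M i) := funext hP
  have hderiv : ∀ u ∈ Set.Icc (0:ℝ) 1, HasDerivAt P (P' u) u := by
    intro u hu
    have hfac : ∀ i ∈ (Finset.univ : Finset (Fin s)),
        HasDerivAt (fun v => (1 - v / a i) ^ (M i))
          ((1 - u / a i) ^ (M i) * ((M i : ℝ) / (u - a i))) u := fun i _ =>
      hasDerivAt_rung_factor (ha0 i) (M i) (rung_base_pos (ha01 i) hu).ne'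
    have key : HasDerivAt (fun v => ∏ i, (1 - v / a i) ^ (M i))
        ((∏ i, (1 - u / a i) ^ (M i)) * ∑ i, (M i : ℝ) / (u - a i)) u := by
      refine (HasDerivAt.fun_finsetProd hfac).congr_deriv ?_
      rw [Finset.mul_sum]
      refine Finset.sum_congr rfl fun i _ => ?_
      rw [smul_eq_mul, ← mul_assoc, Finset.prod_erase_mul _ _ (Finset.mem_univ i)]
    rw [hP' u, hP u, hPfun]
    exact key
  -- continuity
  have hPcont : ContinuousOn P (Set.Icc (0:ℝ) 1) := fun u hu =>
    (hderiv u hu).continuousAt.continuousWithinAt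
  have hP'cont : ContinuousOn P' (Set.Icc (0:ℝ) 1) := by
    have hP'fun : P' = fun u => P u * ∑ i, (M i : ℝ) / (u - a i) := funext hP'
    rw [hP'fun]
    exact hPcont.mul (continuousOn_finsetSum _ fun i _ =>
      continuousOn_const.div (continuousOn_id.sub continuousOn_const)
        fun u hu => rung_sub_ne_zero (ha01 i) hu)
  -- semialgebraicity on the square
  have hS : IsSemialgebraic ℚ (Set.pi Set.univ (fun _ : Fin 2 => Set.Icc (0:ℝ) 1)) := by
    rw [← cube_eq_pi]
    exact isSemialgebraic_cube
  have hx0 : ∀ x ∈ Set.pi Set.univ (fun _ : Fin 2 => Set.Icc (0:ℝ) 1), x 0 ∈ Set.Icc (0:ℝ) 1 :=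
    fun x hx => hx 0 (Set.mem_univ _)
  have h1 : IsSemialgebraicFunOn ℚ (Set.pi Set.univ (fun _ : Fin 2 => Set.Icc (0:ℝ) 1))
      (fun _ => (1:ℝ)) :=
    fold_isSemialgebraicFunOn_one hS
  have hPS : IsSemialgebraicFunOn ℚ (Set.pi Set.univ (fun _ : Fin 2 => Set.Icc (0:ℝ) 1))
      (fun x => ∏ i, (1 - x 0 / a i) ^ (M i)) :=
    IsSemialgebraicFunOn.fun_finsetProd Finset.univ hS fun i _ =>
      fold_fun_zpow (h1.fun_sub ((isSemialgebraicFunOn_apply hS 0).div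
        (isSemialgebraicFunOn_const_of_isAlgebraic hS (ha i)) fun _ _ => ha0 i)) (M i)
  have hsumS : IsSemialgebraicFunOn ℚ (Set.pi Set.univ (fun _ : Fin 2 => Set.Icc (0:ℝ) 1))
      (fun x => ∑ i, (M i : ℝ) / (x 0 - a i)) :=
    IsSemialgebraicFunOn.fun_finsetSum Finset.univ hS fun i _ =>
      (isSemialgebraicFunOn_const_intCast hS (M i)).div
        ((isSemialgebraicFunOn_apply hS 0).fun_sub
          (isSemialgebraicFunOn_const_of_isAlgebraic hS (ha i)))
        fun x hx => rung_sub_ne_zero (ha01 i) (hx0 x hx)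
  refine ⟨hPS.congr fun x _ => (hP (x 0)).symm,
    (hPS.fun_mul hsumS).congr fun x _ => by rw [hP' (x 0), hP (x 0)],
    hPpos, ?_, ?_, hPcont, hP'cont, fun u hu => hderiv u (Set.Ioo_subset_Icc_self hu),
    fun u hu => by rw [hP' u, mul_div_cancel_left₀ _ (hPpos u hu).ne']⟩
  · rw [hP 0]
    simp
  · rw [hP 1]
    simpa only [one_div] using hrel

end Summit.KontsevichZagierPeriods.KontsevichZagierPeriods.Cruxes.StokesGeneration.FibrewiseStokes
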